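import Summits.CriticalPhenomena.SAWScalingLimit.Theorems.SAWWeldingIdentificationWeldingSetupChordArcs

/-!
# The two banks of a simple chord of a four-marked Jordan domain
# (route `SAWWeldingIdentification`, helper for item `WeldingSetup`, stmt-CriticalPhenomena-4504)

Fix a conformal rectangle `Q = (Ω; a, c_L, b, c_R)` and a simple chord `γ` of `(Ω; a, b)`. This file
supplies the plane topology behind the "banks" clause of the route items `WeldingSetup` /
`WeldingRigidity` / `WeldingContinuity`:

* `exists_banks` — Newman's cross-cut theorem (tree: `Newman1939_crosscut_holds`): `Ω ∖ γ` is the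
  disjoint union of two domains `U₁`, `U₂` with `∂U₁ = γ ∪ (arc a → c_L → b)` and
  `∂U₂ = γ ∪ (arc b → c_R → a)`;
* `frontier_banks_eq` — ANY pair `(L, R)` satisfying the route's eight-clause bank condition is
  `(U₁, U₂)`, so its frontiers are known; `frontier_left_diff_eq`, `frontier_right_diff_eq` — the
  decompositions `∂L ∖ {a, b} = A_L ⊔ γ°`, `∂R ∖ {a, b} = A_R ⊔ γ°` consumed by
  `image_Ioi_eq_of_mem` (file `…WeldingSetupArcs`);
* `exists_leftBank_dobrushinDomain`, `exists_rightBank_dobrushinDomain` — the banks as Dobrushin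
  domains `(L; a, b)`, `(R; a, b)` with EXPLICIT boundary loops (`concatPath` of the boundary arc
  and a parametrisation of the chord, periodised), so that loops of nearby chords are uniformly
  close.

No new definitions. References: M. H. A. Newman, *Elements of the topology of plane sets of
points* (1939), Ch. V §11, Thms. 11·7–11·8; Ch. Pommerenke, *Boundary Behaviour of Conformal
Maps* (1992), §2.2.
-/

noncomputable section

namespace Summit.CriticalPhenomena.SAWScalingLimit.Theorems

open Set Filter Topology Complex Metric Function
open Literature.Probability.RandomPlanarGeometry Literature.Topology.PlaneTopology

variable {Q : ConformalRectangle} {γ : CurveClass ℂ}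

section Chord

variable (hγ : (Q.chord 0 2 (by decide)).IsSimpleChord γ)
include hγ

/-! ### The banks -/

/-- **The banks of a simple chord** (Newman's cross-cut theorem, tree:
`Newman1939_crosscut_holds`): `Ω ∖ γ = U₁ ⊔ U₂` with `U₁`, `U₂` open connected,
`∂U₁ = γ ∪ boundary [m₀, m₂]` (the arc through `c_L`) and `∂U₂ = γ ∪ boundary [m₂, m₀ + 1]` (the
arc through `c_R`). [cite: Newman1939, Ch. V §11, Thms. 11·7 and 11·8] -/
theorem exists_banks :
    ∃ U₁ U₂ : Set ℂ, IsOpen U₁ ∧ IsOpen U₂ ∧ IsConnected U₁ ∧ IsConnected U₂ ∧ Disjoint U₁ U₂ ∧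
      U₁ ∪ U₂ = Q.carrier \ γ.range ∧
      frontier U₁ = γ.range ∪ Q.boundary '' Icc (Q.mark 0) (Q.mark 2) ∧
      frontier U₂ = γ.range ∪ Q.boundary '' Icc (Q.mark 2) (Q.mark 0 + 1) :=
  Newman1939_crosscut_holds Q.toJordanDomain γ.range (Q.mark 0) (Q.mark 2) (mark_zero_lt_mark_two Q)
    (mark_two_lt_mark_zero_add_one Q) (isCrosscut_range hγ)

/-- `c_L` is not in the closure of the bank `U₂` (whose frontier is `γ ∪ boundary [m₂, m₀ + 1]`).
[folklore] -/
theorem pt_one_notMem_closure {U : Set ℂ} (hU : U ⊆ Q.carrier)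
    (hfr : frontier U = γ.range ∪ Q.boundary '' Icc (Q.mark 2) (Q.mark 0 + 1)) :
    Q.pt 1 ∉ closure U := by
  rw [closure_eq_self_union_frontier, hfr, image_Icc_right_eq]
  have h1 := pt_one_mem_arc Q
  rintro (h | h | h | h)
  · exact (Q.pt_mem_frontier 1).2 (by rw [Q.isOpen.interior_eq]; exact hU h)
  · exact Set.disjoint_left.1 (disjoint_range_arc_left hγ) h h1
  · exact Set.disjoint_left.1 (disjoint_arcs Q) h1 h
  · rcases h with h | h
    · exact absurd (Q.pt_injective h) (by decide)
    · exact absurd (Q.pt_injective h) (by decide)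

/-- `c_R` is not in the closure of the bank `U₁` (whose frontier is `γ ∪ boundary [m₀, m₂]`).
[folklore] -/
theorem pt_three_notMem_closure {U : Set ℂ} (hU : U ⊆ Q.carrier)
    (hfr : frontier U = γ.range ∪ Q.boundary '' Icc (Q.mark 0) (Q.mark 2)) :
    Q.pt 3 ∉ closure U := by
  rw [closure_eq_self_union_frontier, hfr, image_Icc_left_eq]
  have h3 := pt_three_mem_arc Q
  rintro (h | h | h | h)
  · exact (Q.pt_mem_frontier 3).2 (by rw [Q.isOpen.interior_eq]; exact hU h)
  · exact Set.disjoint_left.1 (disjoint_range_arc_right hγ) h h3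
  · exact Set.disjoint_left.1 (disjoint_arcs Q) h h3
  · rcases h with h | h
    · exact absurd (Q.pt_injective h) (by decide)
    · exact absurd (Q.pt_injective h) (by decide)

/-- **Uniqueness of the banks.** Any pair `(L, R)` satisfying the route's bank clause (disjoint
open connected sets with `L ∪ R = Ω ∖ γ`, `c_L ∈ closure L`, `c_R ∈ closure R`) is the pair of
components of Newman's theorem; in particular `∂L = γ ∪ boundary [m₀, m₂]` and
`∂R = γ ∪ boundary [m₂, m₀ + 1]`. [folklore] -/
theorem frontier_banks_eq {L R : Set ℂ}
    (h : L ∪ R = Q.carrier \ γ.range ∧ Disjoint L R ∧ IsOpen L ∧ IsOpen R ∧ IsConnected L ∧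
      IsConnected R ∧ Q.pt 1 ∈ closure L ∧ Q.pt 3 ∈ closure R) :
    frontier L = γ.range ∪ Q.boundary '' Icc (Q.mark 0) (Q.mark 2) ∧
      frontier R = γ.range ∪ Q.boundary '' Icc (Q.mark 2) (Q.mark 0 + 1) := by
  obtain ⟨hLR, hdisj, hLo, hRo, hLc, hRc, h1, h3⟩ := h
  obtain ⟨U₁, U₂, hU₁o, hU₂o, hU₁c, hU₂c, hUdisj, hU, hf₁, hf₂⟩ := exists_banks hγ
  have hU₁Q : U₁ ⊆ Q.carrier := fun z hz => by
    have h' : z ∈ U₁ ∪ U₂ := Or.inl hz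
    rw [hU] at h'
    exact h'.1
  have hU₂Q : U₂ ⊆ Q.carrier := fun z hz => by
    have h' : z ∈ U₁ ∪ U₂ := Or.inr hz
    rw [hU] at h'
    exact h'.1
  have hLsub : L ⊆ U₁ ∪ U₂ := by rw [hU, ← hLR]; exact subset_union_left
  have hRsub : R ⊆ U₁ ∪ U₂ := by rw [hU, ← hLR]; exact subset_union_right
  -- `L ⊆ U₁` and `R ⊆ U₂`
  have hL : L ⊆ U₁ := by
    rcases hLc.isPreconnected.subset_or_subset hU₁o hU₂o hUdisj hLsub with h | h
    · exact h
    · exact absurd (closure_mono h h1) (pt_one_notMem_closure hγ hU₂Q hf₂)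
  have hR : R ⊆ U₂ := by
    rcases hRc.isPreconnected.subset_or_subset hU₁o hU₂o hUdisj hRsub with h | h
    · exact absurd (closure_mono h h3) (pt_three_notMem_closure hγ hU₁Q hf₁)
    · exact h
  -- hence equalities
  have hL' : U₁ ⊆ L := fun z hz => by
    have : z ∈ L ∪ R := by rw [hLR, ← hU]; exact Or.inl hz
    rcases this with h | h
    · exact h
    · exact absurd (hR h) (Set.disjoint_left.1 hUdisj hz)
  have hR' : U₂ ⊆ R := fun z hz => by
    have : z ∈ L ∪ R := by rw [hLR, ← hU]; exact Or.inr hz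
    rcases this with h | h
    · exact absurd hz (Set.disjoint_left.1 hUdisj (hL h))
    · exact h
  rw [hL.antisymm hL', hR.antisymm hR']
  exact ⟨hf₁, hf₂⟩

omit hγ in
/-- The frontier of the left bank minus `{a, b}` is `A_L ⊔ γ°`. [folklore] -/
theorem frontier_left_diff_eq {L : Set ℂ} (hfr : frontier L = γ.range ∪ Q.boundary '' Icc (Q.mark 0) (Q.mark 2)) :
    Q.boundary '' Ioo (Q.mark 0) (Q.mark 2) ∪ (γ.range \ {Q.pt 0, Q.pt 2}) = frontier L \ {Q.pt 0, Q.pt 2} := by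
  rw [hfr, image_Icc_left_eq]
  ext z
  simp only [mem_union, Set.mem_sdiff, mem_insert_iff, mem_singleton_iff]
  constructor
  · rintro (⟨t, ht, rfl⟩ | ⟨hz, hne⟩)
    · exact ⟨Or.inr (Or.inl ⟨t, ht, rfl⟩), not_or.2 (boundary_ne_of_mem_Ioo_left ht)⟩
    · exact ⟨Or.inl hz, hne⟩
  · rintro ⟨h | h | h, hne⟩
    · exact Or.inr ⟨h, hne⟩
    · exact Or.inl h
    · exact absurd h hne

omit hγ in
/-- The frontier of the right bank minus `{a, b}` is `A_R ⊔ γ°`. [folklore] -/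
theorem frontier_right_diff_eq {R : Set ℂ}
    (hfr : frontier R = γ.range ∪ Q.boundary '' Icc (Q.mark 2) (Q.mark 0 + 1)) :
    Q.boundary '' Ioo (Q.mark 2) (Q.mark 0 + 1) ∪ (γ.range \ {Q.pt 0, Q.pt 2}) =
      frontier R \ {Q.pt 0, Q.pt 2} := by
  rw [hfr, image_Icc_right_eq]
  ext z
  simp only [mem_union, Set.mem_sdiff, mem_insert_iff, mem_singleton_iff]
  constructor
  · rintro (⟨t, ht, rfl⟩ | ⟨hz, hne⟩)
    · exact ⟨Or.inr (Or.inl ⟨t, ht, rfl⟩), not_or.2 (boundary_ne_of_mem_Ioo_right ht)⟩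
    · exact ⟨Or.inl hz, hne⟩
  · rintro ⟨h | h | h, hne⟩
    · exact Or.inr ⟨h, hne⟩
    · exact Or.inl h
    · exact absurd h hne

end Chord

/-! ### The banks as Dobrushin domains with explicit boundary loops -/

section Loops

variable (hγ : (Q.chord 0 2 (by decide)).IsSimpleChord γ)
include hγ

/-- **The left bank as a Dobrushin domain `(L; a, b)`** with the explicit boundary loop "boundary
arc from `a` through `c_L` to `b`, then the chord backwards" (`concatPath`, periodised): for any
parametrisation `p` of the chord (`p [0,1] = γ`, injective, `p 0 = a`, `p 1 = b`) and any `L`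
with `∂L = γ ∪ boundary [m₀, m₂]` from the bank clause. [folklore] -/
theorem exists_leftBank_dobrushinDomain {L R : Set ℂ}
    (h : L ∪ R = Q.carrier \ γ.range ∧ Disjoint L R ∧ IsOpen L ∧ IsOpen R ∧ IsConnected L ∧
      IsConnected R ∧ Q.pt 1 ∈ closure L ∧ Q.pt 3 ∈ closure R)
    {p : ℝ → ℂ} (hp : Continuous p) (hpinj : InjOn p (Icc 0 1)) (hprange : p '' Icc 0 1 = γ.range)
    (hp0 : p 0 = Q.pt 0) (hp1 : p 1 = Q.pt 2) :
    ∃ D : DobrushinDomain, D.carrier = L ∧ D.pt 0 = Q.pt 0 ∧ D.pt 1 = Q.pt 2 ∧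
      D.boundary = concatPath (fun t => Q.boundary (Q.mark 0 + t * (Q.mark 2 - Q.mark 0)))
        (fun t => p (1 - t)) ∘ Int.fract := by
  have hfr := (frontier_banks_eq hγ h).1
  obtain ⟨hLR, -, hLo, -, hLc, -, -, -⟩ := h
  set α : ℝ → ℂ := fun t => Q.boundary (Q.mark 0 + t * (Q.mark 2 - Q.mark 0)) with hα
  set β : ℝ → ℂ := fun t => p (1 - t) with hβ
  have h02 := mark_zero_lt_mark_two Q
  have h20 := mark_two_lt_mark_zero_add_one Q
  have hαc : Continuous α := Q.continuous_boundary.comp (by fun_prop)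
  have hβc : Continuous β := hp.comp (by fun_prop)
  have hα0 : α 0 = Q.pt 0 := by simp [hα]; rfl
  have hα1 : α 1 = Q.pt 2 := by simp [hα]; rfl
  have hβ0 : β 0 = Q.pt 2 := by simp [hβ, hp1]
  have hβ1 : β 1 = Q.pt 0 := by simp [hβ, hp0]
  have hαβ : α 1 = β 0 := hα1.trans hβ0.symm
  have hβα : β 1 = α 0 := hβ1.trans hα0.symm
  have hmemα : ∀ t ∈ Icc (0 : ℝ) 1, Q.mark 0 + t * (Q.mark 2 - Q.mark 0) ∈ Icc (Q.mark 0) (Q.mark 2) :=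
    fun t ht => ⟨by nlinarith [ht.1], by nlinarith [ht.2]⟩
  have hαimg : α '' Icc 0 1 = Q.boundary '' Icc (Q.mark 0) (Q.mark 2) := by
    ext z
    constructor
    · rintro ⟨t, ht, rfl⟩
      exact ⟨_, hmemα t ht, rfl⟩
    · rintro ⟨v, hv, rfl⟩
      refine ⟨(v - Q.mark 0) / (Q.mark 2 - Q.mark 0), ⟨div_nonneg (by linarith [hv.1]) (by linarith),
        (div_le_one (by linarith)).2 (by linarith [hv.2])⟩, ?_⟩
      simp only [hα]
      congr 1
      rw [div_mul_cancel₀ _ (ne_of_gt (sub_pos.2 h02))]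
      ring
  have hβimg : β '' Icc 0 1 = γ.range := by
    rw [← hprange]
    ext z
    constructor
    · rintro ⟨t, ht, rfl⟩
      exact ⟨1 - t, ⟨by linarith [ht.2], by linarith [ht.1]⟩, rfl⟩
    · rintro ⟨t, ht, rfl⟩
      exact ⟨1 - t, ⟨by linarith [ht.2], by linarith [ht.1]⟩, by simp [hβ]⟩
  have hαinj : InjOn α (Icc 0 1) := by
    intro u hu u' hu' heq
    have h1 := Q.injOn_boundary_Icc h20 (hmemα u hu) (hmemα u' hu') heq
    have : u * (Q.mark 2 - Q.mark 0) = u' * (Q.mark 2 - Q.mark 0) := by linarith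
    exact mul_right_cancel₀ (by linarith) this
  have hβinj : InjOn β (Icc 0 1) := by
    intro u hu u' hu' heq
    have h1 := hpinj ⟨by linarith [hu.2], by linarith [hu.1]⟩ ⟨by linarith [hu'.2], by linarith [hu'.1]⟩ heq
    linarith
  have hmeet : α '' Icc 0 1 ∩ β '' Icc 0 1 ⊆ {α 1, α 0} := by
    rw [hαimg, hβimg, hα1, hα0]
    rintro z ⟨hzA, hzγ⟩
    have := hγ.range_inter_frontier_subset ⟨hzγ, (isCrosscut_range hγ).1.isCompact.isClosed.closure_subset
      (subset_closure hzγ) |> fun _ => by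
        obtain ⟨t, -, rfl⟩ := hzA; exact Q.boundary_mem_frontier t⟩
    simp only [mem_insert_iff, mem_singleton_iff] at this ⊢
    tauto
  set f : ℝ → ℂ := concatPath α β with hf
  have hfc : Continuous f := continuous_concatPath hαc hβc hαβ
  have hf01 : f 0 = f 1 := by rw [hf, concatPath_zero, concatPath_one, hβα]
  have hloopc : Continuous (f ∘ Int.fract) := hfc.continuousOn.comp_fract'' hf01
  have hrange : range (f ∘ Int.fract) = frontier L := by
    rw [range_comp_fract hf01, hf, image_concatPath_Icc_zero_one hαβ, hαimg, hβimg, hfr, union_comm]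
  refine ⟨⟨⟨L, f ∘ Int.fract, hLo, Q.isBounded.subset fun z hz => by
      have h' : z ∈ L ∪ R := Or.inl hz
      rw [hLR] at h'
      exact h'.1,
    hLc, hloopc, periodic_comp_fract, injOn_comp_fract (injOn_concatPath_Ico hαinj hβinj hαβ hβα hmeet),
    hrange⟩, ![0, 1 / 2], ?_, ?_⟩, rfl, ?_, ?_, rfl⟩
  · refine Fin.strictMono_iff_lt_succ.2 fun k => ?_
    fin_cases k
    norm_num
  · intro k
    fin_cases k <;> norm_num
  · show (f ∘ Int.fract) 0 = Q.pt 0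
    simp [hf, hα0]
  · show (f ∘ Int.fract) (1 / 2) = Q.pt 2
    have : Int.fract (1 / 2 : ℝ) = 1 / 2 := Int.fract_eq_self.2 ⟨by norm_num, by norm_num⟩
    simp only [Function.comp_apply, this, hf, concatPath_half, hα1]

/-- **The right bank as a Dobrushin domain `(R; a, b)`** with the explicit boundary loop "the
chord from `a` to `b`, then the boundary arc from `b` through `c_R` back to `a`". [folklore] -/
theorem exists_rightBank_dobrushinDomain {L R : Set ℂ}
    (h : L ∪ R = Q.carrier \ γ.range ∧ Disjoint L R ∧ IsOpen L ∧ IsOpen R ∧ IsConnected L ∧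
      IsConnected R ∧ Q.pt 1 ∈ closure L ∧ Q.pt 3 ∈ closure R)
    {p : ℝ → ℂ} (hp : Continuous p) (hpinj : InjOn p (Icc 0 1)) (hprange : p '' Icc 0 1 = γ.range)
    (hp0 : p 0 = Q.pt 0) (hp1 : p 1 = Q.pt 2) :
    ∃ D : DobrushinDomain, D.carrier = R ∧ D.pt 0 = Q.pt 0 ∧ D.pt 1 = Q.pt 2 ∧
      D.boundary = concatPath p
        (fun t => Q.boundary (Q.mark 2 + t * (Q.mark 0 + 1 - Q.mark 2))) ∘ Int.fract := by
  have hfr := (frontier_banks_eq hγ h).2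
  obtain ⟨hLR, -, -, hRo, -, hRc, -, -⟩ := h
  set α : ℝ → ℂ := fun t => Q.boundary (Q.mark 2 + t * (Q.mark 0 + 1 - Q.mark 2)) with hα
  have h02 := mark_zero_lt_mark_two Q
  have h20 := mark_two_lt_mark_zero_add_one Q
  have hαc : Continuous α := Q.continuous_boundary.comp (by fun_prop)
  have hα0 : α 0 = Q.pt 2 := by simp [hα]; rfl
  have hα1 : α 1 = Q.pt 0 := by
    simp only [hα, one_mul, add_sub_cancel]
    exact boundary_mark_zero_add_one Q
  have hpα : p 1 = α 0 := hp1.trans hα0.symm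
  have hαp : α 1 = p 0 := hα1.trans hp0.symm
  have hmemα : ∀ t ∈ Icc (0 : ℝ) 1,
      Q.mark 2 + t * (Q.mark 0 + 1 - Q.mark 2) ∈ Icc (Q.mark 2) (Q.mark 0 + 1) :=
    fun t ht => ⟨by nlinarith [ht.1], by nlinarith [ht.2]⟩
  have hαimg : α '' Icc 0 1 = Q.boundary '' Icc (Q.mark 2) (Q.mark 0 + 1) := by
    ext z
    constructor
    · rintro ⟨t, ht, rfl⟩
      exact ⟨_, hmemα t ht, rfl⟩
    · rintro ⟨v, hv, rfl⟩
      refine ⟨(v - Q.mark 2) / (Q.mark 0 + 1 - Q.mark 2),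
        ⟨div_nonneg (by linarith [hv.1]) (by linarith), (div_le_one (by linarith)).2 (by linarith [hv.2])⟩, ?_⟩
      simp only [hα]
      congr 1
      rw [div_mul_cancel₀ _ (by linarith : Q.mark 0 + 1 - Q.mark 2 ≠ 0)]
      ring
  have hαinj : InjOn α (Icc 0 1) := by
    intro u hu u' hu' heq
    have h1 := Q.injOn_boundary_Icc (by linarith) (hmemα u hu) (hmemα u' hu') heq
    have : u * (Q.mark 0 + 1 - Q.mark 2) = u' * (Q.mark 0 + 1 - Q.mark 2) := by linarith
    exact mul_right_cancel₀ (by linarith) this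
  have hmeet : p '' Icc 0 1 ∩ α '' Icc 0 1 ⊆ {p 1, p 0} := by
    rw [hαimg, hprange, hp1, hp0]
    rintro z ⟨hzγ, hzA⟩
    have := hγ.range_inter_frontier_subset ⟨hzγ, by
      obtain ⟨t, -, rfl⟩ := hzA; exact Q.boundary_mem_frontier t⟩
    simp only [mem_insert_iff, mem_singleton_iff] at this ⊢
    tauto
  set f : ℝ → ℂ := concatPath p α with hf
  have hfc : Continuous f := continuous_concatPath hp hαc hpα
  have hf01 : f 0 = f 1 := by rw [hf, concatPath_zero, concatPath_one, hαp]
  have hloopc : Continuous (f ∘ Int.fract) := hfc.continuousOn.comp_fract'' hf01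
  have hrange : range (f ∘ Int.fract) = frontier R := by
    rw [range_comp_fract hf01, hf, image_concatPath_Icc_zero_one hpα, hαimg, hprange, hfr]
  refine ⟨⟨⟨R, f ∘ Int.fract, hRo, Q.isBounded.subset fun z hz => by
      have h' : z ∈ L ∪ R := Or.inr hz
      rw [hLR] at h'
      exact h'.1,
    hRc, hloopc, periodic_comp_fract, injOn_comp_fract (injOn_concatPath_Ico hpinj hαinj hpα hαp hmeet),
    hrange⟩, ![0, 1 / 2], ?_, ?_⟩, rfl, ?_, ?_, rfl⟩
  · refine Fin.strictMono_iff_lt_succ.2 fun k => ?_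
    fin_cases k
    norm_num
  · intro k
    fin_cases k <;> norm_num
  · show (f ∘ Int.fract) 0 = Q.pt 0
    simp [hf, hp0]
  · show (f ∘ Int.fract) (1 / 2) = Q.pt 2
    have : Int.fract (1 / 2 : ℝ) = 1 / 2 := Int.fract_eq_self.2 ⟨by norm_num, by norm_num⟩
    simp only [Function.comp_apply, this, hf, concatPath_half, hp1]

end Loops

end Summit.CriticalPhenomena.SAWScalingLimit.Theorems
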